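import Summits.QuantumFields.YangMills.Theorems.BalabanUVNodesPortZDRecordHistoryFluctuation
import Summits.QuantumFields.YangMills.Theorems.BalabanUVNodesPortZDZeroInputMeasureSplit

/-!
# NODE O port, row PT-A′ (PTZ-1, gen 3): THE TWO SLOTS OF 26648 AT THE RECORD, TO FIRST ORDER — (Z) `recordΦzAx = ↑(measure term + P^{(k)}-moment)` ((2.12)'s «sum of two terms» at the
# [Ax-4] names) and (L) `recordΦfAx − recordΦzAx` = its first-order fibre value up to two second cumulants — record corollaries of this seat's generic rows with the transport's
# homogeneity DISCHARGED (`PortZD.hT_TcanOfRecord`); fibre laws, positivity and a.e. bounds DISPLAYED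

[Balaban1987RG1] = [I] (CMP 109, 1987): (0.19) p. 255–256, (1.6) p. 261, (2.6)–(2.8) p. 266, (2.12)–(2.14) p. 268; [Balaban1988RG2Cluster] = [II] (CMP 116, 1988): Lemma 3 (2.38) p. 20, p. 21.

Seat `ymgap-nodeO-port-PTZ-1` g3 (prover, HELPER MODE; `--supports stmt-QuantumFields-26648 --as helper` per port-lead SLOT RE-KEYED 01:00:34Z; NO `--workitem`).  DEPENDENT rows (names
`recordΦzAx`, `recordΦfAx`, `chiβOfRecord₁₃Ax`).  With `θ := thetaFill F a₀ ε₂₉`, `T := TβOfRecord₁₃ F 2`, `χ := chiβOfRecord₁₃Ax F 2 θ`, `g := extd v`, `W_B := unitField F θ k K B`,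
`A⁰_k := mainTermT F 2 θ.εbg K g k`, `𝐄_k := EkT F 2 T χ θ.εbg K g k`, `I(A) := χ_k e^{−GF_k∕g_k² + A}`, `bg_W := Ū^k U_{k+1} W`.
WHAT IS PROVED (0 sorry; no `def` ∕ `instance` ∕ `notation`):
* ★★ `recordZ_eq_measureTerm_add_log_fluct` — (Z): `recordΦzAx k v K B = ↑( 𝐓_k(0)(W_B) + log⟨e^{A⁰_k − A⁰_k(bg_{W_B})}⟩^{GF}_{W_B} − log[𝐍_k(A⁰_k) ∕ 𝐍_k(0)] )` (`0 < a₀`, `k + 1 ≤ m + K`; the zero-action and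
  zero-input steps defined at `W_B`, `1` — displayed): the zero-input piece functional is the MEASURE TERM plus the `P^{(k)}`-MOMENT, value by value.
* ★★ `recordChannel_sub_firstOrder_le_var` — (L): `|(the real part behind) recordΦfAx − recordΦzAx − (⟨𝐄_k − 𝐄_k(bg_{W_B})⟩⁰_{W_B} − ⟨𝐄_k − 𝐄_k(bg_1)⟩⁰_1) + 𝐄_k(bg_1)| ≤ Var⁰_{W_B} + Var⁰_1`
  (fibre laws of the record's ZERO-INPUT step at `W_B` and at `1` displayed through `hμ`; centred brackets `≤ 1` a.e.; exponential moments finite).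
HONEST FRAMING.  One-line record corollaries; the displayed hypotheses are NOT discharged; NOTHING of Bałaban's estimates asserted, ported or discharged; 26648 ∕ 27930⁸ SIGNED·OPEN
(content-gated), 27931 OPEN (RC-3), 27932 CLOSED; K0⁷ ∕ K-Ax OPEN; counts unmoved; finite 𝕋⁴ at fixed ε — NOT continuum ∕ OS ∕ Clay; the Yang–Mills mass gap is NOT proved by any of this.
No `sorry`, no `instance`, no `notation`, no `def`.
-/

noncomputable section

open MeasureTheory

namespace Summit.QuantumFields.YangMills.Theorems.PortZDRecord

open Literature.MathematicalPhysics.QuantumFieldTheory.Balaban1983to89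
open Literature.MathematicalPhysics.QuantumFieldTheory.Balaban1983to89.Node00
open Literature.MathematicalPhysics.QuantumFieldTheory.Balaban1983to89.Node00.ZeroInput
open Literature.MathematicalPhysics.QuantumFieldTheory.Balaban1983to89.T4Continuum (T4Family)
open Summit.QuantumFields.YangMills.Theorems.K0RecordFormatNames
open B12Eq019ActionBody (nextAction integrand normConst)

variable (F : T4Family) (a₀ ε₂₉ : ℝ)

/-- ★★ **(Z) AT THE RECORD IS THE MEASURE TERM PLUS THE `P^{(k)}`-MOMENT**: `recordΦzAx k v K B = ↑( 𝐓_k(0)(W_B) + log⟨e^{A⁰_k − A⁰_k(bg_{W_B})}⟩^{GF}_{W_B} − log[𝐍_k(A⁰_k) ∕ 𝐍_k(0)] )`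
(`PortZD.zeroInputMergedTermT_eq_measureTerm_add_log_fluct_of_unit` at the record's transport, `hT` discharged; `0 < a₀`, `k + 1 ≤ m + K`, positivity displayed).
[cite: Balaban1987RG1, (0.19) p.255–256, (2.6)–(2.8) p.266, (2.12)–(2.13) p.268; Balaban1988RG2Cluster, p.21] -/
theorem recordZ_eq_measureTerm_add_log_fluct (ha₀ : 0 < a₀) {k : ℕ} (v : Fin (k + 1) → ℝ) {K : ℕ} (hk : k + 1 ≤ (F.P K).m + (F.P K).K)
    (B : recordW F a₀ ε₂₉ k K)
    (hZW : 0 < TβOfRecord₁₃ F 2 K k (integrand (chiβOfRecord₁₃Ax F 2 (thetaFill F a₀ ε₂₉) K (T4FlagMemory.extd v) k) (gfOfRecord F 2 K k) (T4FlagMemory.extd v k) 0)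
      (unitField F (thetaFill F a₀ ε₂₉) k K B))
    (hZ1 : 0 < TβOfRecord₁₃ F 2 K k (integrand (chiβOfRecord₁₃Ax F 2 (thetaFill F a₀ ε₂₉) K (T4FlagMemory.extd v) k) (gfOfRecord F 2 K k) (T4FlagMemory.extd v k) 0) 1)
    (h0W : 0 < TβOfRecord₁₃ F 2 K k (integrand (chiβOfRecord₁₃Ax F 2 (thetaFill F a₀ ε₂₉) K (T4FlagMemory.extd v) k) (gfOfRecord F 2 K k) (T4FlagMemory.extd v k)
      (mainTermT F 2 (thetaFill F a₀ ε₂₉).εbg K (T4FlagMemory.extd v) k)) (unitField F (thetaFill F a₀ ε₂₉) k K B))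
    (h01 : 0 < TβOfRecord₁₃ F 2 K k (integrand (chiβOfRecord₁₃Ax F 2 (thetaFill F a₀ ε₂₉) K (T4FlagMemory.extd v) k) (gfOfRecord F 2 K k) (T4FlagMemory.extd v k)
      (mainTermT F 2 (thetaFill F a₀ ε₂₉).εbg K (T4FlagMemory.extd v) k)) 1) :
    letI θ := thetaFill F a₀ ε₂₉
    letI T := TβOfRecord₁₃ F 2
    letI χ := chiβOfRecord₁₃Ax F 2 θ
    letI g := T4FlagMemory.extd v
    letI W := unitField F θ k K B
    recordΦzAx F a₀ ε₂₉ k v K B =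
      ((nextAction (T K k) (χ K g k) (gfOfRecord F 2 K k) (g k) 0 W +
        (Real.log (T K k (integrand (χ K g k) (gfOfRecord F 2 K k) (g k)
            (0 + fun U => mainTermT F 2 θ.εbg K g k U - mainTermT F 2 θ.εbg K g k (Averaging.iter (avOfRecord F 2 K) k (Uk F 2 K (k + 1) θ.εbg W)))) W /
          T K k (integrand (χ K g k) (gfOfRecord F 2 K k) (g k) 0) W) -
        Real.log (normConst (T K k) (χ K g k) (gfOfRecord F 2 K k) (g k) (mainTermT F 2 θ.εbg K g k) /
          normConst (T K k) (χ K g k) (gfOfRecord F 2 K k) (g k) 0)) : ℝ) : ℂ) := by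
  have hε : 0 < (thetaFill F a₀ ε₂₉).εbg := ha₀
  rw [recordΦzAx_eq_stepOutT, ← zeroInputMergedTermT_eq_stepOut,
    PortZD.zeroInputMergedTermT_eq_measureTerm_add_log_fluct_of_unit F 2 (TβOfRecord₁₃ F 2) (chiβOfRecord₁₃Ax F 2 (thetaFill F a₀ ε₂₉)) hε
      (T4FlagMemory.extd v) hk (PortZD.hT_TcanOfRecord F 2 K k) _ hZW hZ1 h0W h01]

/-- ★★ **(L) AT THE RECORD TO FIRST ORDER**: the history channel behind `recordΦfAx − recordΦzAx` equals the fibre expectation of print's curly bracket under the record's ZERO-INPUT step at `W_B`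
minus at `1` (minus the unit value `𝐄_k(bg_1)`), up to the two second cumulants (`PortZD.abs_stepOutT_add_sub_sub_firstOrder_le_var` at the record's transport, `hT` discharged; fibre laws
displayed through `hμW`, `hμ1`). [cite: Balaban1987RG1, (1.6) p.261, (2.12)–(2.14) p.268; Balaban1988RG2Cluster, Lemma 3 (2.38) p.20, p.21] -/
theorem recordChannel_sub_firstOrder_le_var {k : ℕ} (v : Fin (k + 1) → ℝ) {K : ℕ} (B : recordW F a₀ ε₂₉ k K) {μW μ1 : Measure (GaugeField (F.P K) k (SU 2))}
    (hμW : ∀ f : Density (F.P K) k (SU 2),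
      ∫ U, f U ∂μW = TβOfRecord₁₃ F 2 K k (fun U => f U * integrand (chiβOfRecord₁₃Ax F 2 (thetaFill F a₀ ε₂₉) K (T4FlagMemory.extd v) k) (gfOfRecord F 2 K k)
          (T4FlagMemory.extd v k) (mainTermT F 2 (thetaFill F a₀ ε₂₉).εbg K (T4FlagMemory.extd v) k) U) (unitField F (thetaFill F a₀ ε₂₉) k K B) /
        TβOfRecord₁₃ F 2 K k (integrand (chiβOfRecord₁₃Ax F 2 (thetaFill F a₀ ε₂₉) K (T4FlagMemory.extd v) k) (gfOfRecord F 2 K k) (T4FlagMemory.extd v k)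
          (mainTermT F 2 (thetaFill F a₀ ε₂₉).εbg K (T4FlagMemory.extd v) k)) (unitField F (thetaFill F a₀ ε₂₉) k K B))
    (hμ1 : ∀ f : Density (F.P K) k (SU 2),
      ∫ U, f U ∂μ1 = TβOfRecord₁₃ F 2 K k (fun U => f U * integrand (chiβOfRecord₁₃Ax F 2 (thetaFill F a₀ ε₂₉) K (T4FlagMemory.extd v) k) (gfOfRecord F 2 K k)
          (T4FlagMemory.extd v k) (mainTermT F 2 (thetaFill F a₀ ε₂₉).εbg K (T4FlagMemory.extd v) k) U) 1 /
        TβOfRecord₁₃ F 2 K k (integrand (chiβOfRecord₁₃Ax F 2 (thetaFill F a₀ ε₂₉) K (T4FlagMemory.extd v) k) (gfOfRecord F 2 K k) (T4FlagMemory.extd v k)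
          (mainTermT F 2 (thetaFill F a₀ ε₂₉).εbg K (T4FlagMemory.extd v) k)) 1)
    (h0W : 0 < TβOfRecord₁₃ F 2 K k (integrand (chiβOfRecord₁₃Ax F 2 (thetaFill F a₀ ε₂₉) K (T4FlagMemory.extd v) k) (gfOfRecord F 2 K k) (T4FlagMemory.extd v k)
      (mainTermT F 2 (thetaFill F a₀ ε₂₉).εbg K (T4FlagMemory.extd v) k)) (unitField F (thetaFill F a₀ ε₂₉) k K B))
    (h01 : 0 < TβOfRecord₁₃ F 2 K k (integrand (chiβOfRecord₁₃Ax F 2 (thetaFill F a₀ ε₂₉) K (T4FlagMemory.extd v) k) (gfOfRecord F 2 K k) (T4FlagMemory.extd v k)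
      (mainTermT F 2 (thetaFill F a₀ ε₂₉).εbg K (T4FlagMemory.extd v) k)) 1)
    (hmW : AEStronglyMeasurable (fun U =>
      EkT F 2 (TβOfRecord₁₃ F 2) (chiβOfRecord₁₃Ax F 2 (thetaFill F a₀ ε₂₉)) (thetaFill F a₀ ε₂₉).εbg K (T4FlagMemory.extd v) k U -
      EkT F 2 (TβOfRecord₁₃ F 2) (chiβOfRecord₁₃Ax F 2 (thetaFill F a₀ ε₂₉)) (thetaFill F a₀ ε₂₉).εbg K (T4FlagMemory.extd v) k
        (Averaging.iter (avOfRecord F 2 K) k (Uk F 2 K (k + 1) (thetaFill F a₀ ε₂₉).εbg (unitField F (thetaFill F a₀ ε₂₉) k K B)))) μW)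
    (hm1 : AEStronglyMeasurable (fun U =>
      EkT F 2 (TβOfRecord₁₃ F 2) (chiβOfRecord₁₃Ax F 2 (thetaFill F a₀ ε₂₉)) (thetaFill F a₀ ε₂₉).εbg K (T4FlagMemory.extd v) k U -
      EkT F 2 (TβOfRecord₁₃ F 2) (chiβOfRecord₁₃Ax F 2 (thetaFill F a₀ ε₂₉)) (thetaFill F a₀ ε₂₉).εbg K (T4FlagMemory.extd v) k
        (Averaging.iter (avOfRecord F 2 K) k (Uk F 2 K (k + 1) (thetaFill F a₀ ε₂₉).εbg 1))) μ1)
    (heW : Integrable (fun U => Real.exp (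
      EkT F 2 (TβOfRecord₁₃ F 2) (chiβOfRecord₁₃Ax F 2 (thetaFill F a₀ ε₂₉)) (thetaFill F a₀ ε₂₉).εbg K (T4FlagMemory.extd v) k U -
      EkT F 2 (TβOfRecord₁₃ F 2) (chiβOfRecord₁₃Ax F 2 (thetaFill F a₀ ε₂₉)) (thetaFill F a₀ ε₂₉).εbg K (T4FlagMemory.extd v) k
        (Averaging.iter (avOfRecord F 2 K) k (Uk F 2 K (k + 1) (thetaFill F a₀ ε₂₉).εbg (unitField F (thetaFill F a₀ ε₂₉) k K B))))) μW)
    (he1 : Integrable (fun U => Real.exp (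
      EkT F 2 (TβOfRecord₁₃ F 2) (chiβOfRecord₁₃Ax F 2 (thetaFill F a₀ ε₂₉)) (thetaFill F a₀ ε₂₉).εbg K (T4FlagMemory.extd v) k U -
      EkT F 2 (TβOfRecord₁₃ F 2) (chiβOfRecord₁₃Ax F 2 (thetaFill F a₀ ε₂₉)) (thetaFill F a₀ ε₂₉).εbg K (T4FlagMemory.extd v) k
        (Averaging.iter (avOfRecord F 2 K) k (Uk F 2 K (k + 1) (thetaFill F a₀ ε₂₉).εbg 1)))) μ1)
    (hbW : ∀ᵐ U ∂μW, |EkT F 2 (TβOfRecord₁₃ F 2) (chiβOfRecord₁₃Ax F 2 (thetaFill F a₀ ε₂₉)) (thetaFill F a₀ ε₂₉).εbg K (T4FlagMemory.extd v) k U -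
        EkT F 2 (TβOfRecord₁₃ F 2) (chiβOfRecord₁₃Ax F 2 (thetaFill F a₀ ε₂₉)) (thetaFill F a₀ ε₂₉).εbg K (T4FlagMemory.extd v) k
          (Averaging.iter (avOfRecord F 2 K) k (Uk F 2 K (k + 1) (thetaFill F a₀ ε₂₉).εbg (unitField F (thetaFill F a₀ ε₂₉) k K B))) -
        ∫ U', (EkT F 2 (TβOfRecord₁₃ F 2) (chiβOfRecord₁₃Ax F 2 (thetaFill F a₀ ε₂₉)) (thetaFill F a₀ ε₂₉).εbg K (T4FlagMemory.extd v) k U' -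
          EkT F 2 (TβOfRecord₁₃ F 2) (chiβOfRecord₁₃Ax F 2 (thetaFill F a₀ ε₂₉)) (thetaFill F a₀ ε₂₉).εbg K (T4FlagMemory.extd v) k
            (Averaging.iter (avOfRecord F 2 K) k (Uk F 2 K (k + 1) (thetaFill F a₀ ε₂₉).εbg (unitField F (thetaFill F a₀ ε₂₉) k K B)))) ∂μW| ≤ 1)
    (hb1 : ∀ᵐ U ∂μ1, |EkT F 2 (TβOfRecord₁₃ F 2) (chiβOfRecord₁₃Ax F 2 (thetaFill F a₀ ε₂₉)) (thetaFill F a₀ ε₂₉).εbg K (T4FlagMemory.extd v) k U -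
        EkT F 2 (TβOfRecord₁₃ F 2) (chiβOfRecord₁₃Ax F 2 (thetaFill F a₀ ε₂₉)) (thetaFill F a₀ ε₂₉).εbg K (T4FlagMemory.extd v) k
          (Averaging.iter (avOfRecord F 2 K) k (Uk F 2 K (k + 1) (thetaFill F a₀ ε₂₉).εbg 1)) -
        ∫ U', (EkT F 2 (TβOfRecord₁₃ F 2) (chiβOfRecord₁₃Ax F 2 (thetaFill F a₀ ε₂₉)) (thetaFill F a₀ ε₂₉).εbg K (T4FlagMemory.extd v) k U' -
          EkT F 2 (TβOfRecord₁₃ F 2) (chiβOfRecord₁₃Ax F 2 (thetaFill F a₀ ε₂₉)) (thetaFill F a₀ ε₂₉).εbg K (T4FlagMemory.extd v) k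
            (Averaging.iter (avOfRecord F 2 K) k (Uk F 2 K (k + 1) (thetaFill F a₀ ε₂₉).εbg 1))) ∂μ1| ≤ 1) :
    letI θ := thetaFill F a₀ ε₂₉
    letI T := TβOfRecord₁₃ F 2
    letI χ := chiβOfRecord₁₃Ax F 2 θ
    letI g := T4FlagMemory.extd v
    letI W := unitField F θ k K B
    letI E := EkT F 2 T χ θ.εbg K g k
    |(mergedTermT F 2 T χ θ.εbg K g k W - zeroInputMergedTermT F 2 T χ θ.εbg K g k W) + E (Averaging.iter (avOfRecord F 2 K) k (Uk F 2 K (k + 1) θ.εbg 1)) -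
        ((∫ U, (E U - E (Averaging.iter (avOfRecord F 2 K) k (Uk F 2 K (k + 1) θ.εbg W))) ∂μW) -
          ∫ U, (E U - E (Averaging.iter (avOfRecord F 2 K) k (Uk F 2 K (k + 1) θ.εbg 1))) ∂μ1)| ≤
      (∫ U, (E U - E (Averaging.iter (avOfRecord F 2 K) k (Uk F 2 K (k + 1) θ.εbg W)) -
          ∫ U', (E U' - E (Averaging.iter (avOfRecord F 2 K) k (Uk F 2 K (k + 1) θ.εbg W))) ∂μW) ^ 2 ∂μW) +
      ∫ U, (E U - E (Averaging.iter (avOfRecord F 2 K) k (Uk F 2 K (k + 1) θ.εbg 1)) -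
          ∫ U', (E U' - E (Averaging.iter (avOfRecord F 2 K) k (Uk F 2 K (k + 1) θ.εbg 1))) ∂μ1) ^ 2 ∂μ1 ∧
    recordΦfAx F a₀ ε₂₉ k v K B - recordΦzAx F a₀ ε₂₉ k v K B =
      ((mergedTermT F 2 T χ θ.εbg K g k W - zeroInputMergedTermT F 2 T χ θ.εbg K g k W : ℝ) : ℂ) := by
  refine ⟨?_, recordΦfAx_sub_recordΦzAx F a₀ ε₂₉ k v K B⟩
  have h := PortZD.abs_stepOutT_add_sub_sub_firstOrder_le_var F 2 (TβOfRecord₁₃ F 2) (chiβOfRecord₁₃Ax F 2 (thetaFill F a₀ ε₂₉)) (thetaFill F a₀ ε₂₉).εbg K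
    (T4FlagMemory.extd v) k (PortZD.hT_TcanOfRecord F 2 K k) (mainTermT F 2 (thetaFill F a₀ ε₂₉).εbg K (T4FlagMemory.extd v) k)
    (EkT F 2 (TβOfRecord₁₃ F 2) (chiβOfRecord₁₃Ax F 2 (thetaFill F a₀ ε₂₉)) (thetaFill F a₀ ε₂₉).εbg K (T4FlagMemory.extd v) k)
    (unitField F (thetaFill F a₀ ε₂₉) k K B) hμW hμ1 h0W h01 hmW hm1 heW he1 hbW hb1
  rwa [← effActionHT_eq_main_add_Ek_fun, ← mergedTermT_eq_stepOut, ← zeroInputMergedTermT_eq_stepOut] at h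

end Summit.QuantumFields.YangMills.Theorems.PortZDRecord

end
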